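import Literature.AnabelianGeometry.EtaleTheta.LogDivisorModelTateTowerArithmeticProp32iii

/-!
# [EtTh] Def. 3.1 / Prop. 3.2: the arithmetic Tate tower datum over the MLF `ℚ_p` (constant field an MLF, as in print)

S. Mochizuki, *The étale theta function …*, Publ. RIMS **45** (2009) [MochizukiEtTh2009], §3 Def. 3.1 / Prop. 3.2 (PRIMS
PDF p.70: the constant field of the Tate curve is a finite extension of `ℚ_p`, for which print proves assertion
(iii), printed p.297 — wording fixed per referee finding F-D15-12) [cite: MochizukiEtTh2009, Def 3.1 p.70].
abc-iut cell, seat abc-iut-w5-d223 gen 6; in-lineage sequel #4 to `LogDivisorModelTateTowerArithmeticProp32iii.lean`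
(`PadicDivisible.*`).  The lineage's inhabitants of
`TateTowerArith.Datum` so far had GLOBAL constant fields (`ℚ`, `ℚ(i)`); print's constant field is LOCAL.  THIS FILE:
* `PadicDivisible.valuation_primeSpec_self : v_p(p) = exp(−1)` on `ℚ_p` (`p ∈ (p) ∖ (p)²` in `ℤ_[p]`: `p` is not a
  unit);
* **`TateTowerArith.Datum.padic p : Datum ℚ_[p] ℚ_[p]`** — `L = K = ℚ_p`, `v` = the `p`-adic valuation
  (`HeightOneSpectrum.valuation` of `ℤ_[p]` on `ℚ_[p]`), `q = p`, Prop. 3.2 (iii) := `PadicDivisible.units_eq_one_…`;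
  `Aut(ℚ_p/ℚ_p)` is trivial (honest label — a non-trivial local constant-field Galois group needs a finite extension of
  `ℚ_p` as a Mathlib field, not built here); `nonempty_datum_padic`, `constGaloisLaw_padic`,
  `padic_emb_mem_intConst_iff` (integral constants = `ℤ_[p]`-integral elements).
Class (b) MODEL/NV file; no new Prop-valued fact, no `instance`, no notation.  HONEST FRAMING: arithmetic consistency
witness for the typed [EtTh] §3 interfaces (not the formal-scheme Tate tower); nothing of [EtTh] asserted; nothing here
bears on [IUTchIII] Cor. 3.12; no side taken; typed ≠ proved.
-/

noncomputable section

namespace Literature.AnabelianGeometry.EtaleTheta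

open IsDedekindDomain

namespace PadicDivisible

variable (p : ℕ) [hp : Fact p.Prime]

/-- **`v_p(p) = exp(−1)`**: the prime `p` is a uniformizer of the `(p)`-adic valuation of `ℤ_[p]` on `ℚ_[p]`.
[cite: MochizukiEtTh2009, Def 3.1 p.70] -/
theorem valuation_primeSpec_self : (primeSpec p).valuation ℚ_[p] (p : ℚ_[p]) = WithZero.exp (-1) := by
  have hne : (p : ℤ_[p]) ≠ 0 := by exact_mod_cast hp.out.ne_zero
  have hp' : (p : ℚ_[p]) = algebraMap ℤ_[p] ℚ_[p] (p : ℤ_[p]) := by rw [map_natCast]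
  rw [hp', HeightOneSpectrum.valuation_of_algebraMap]
  have hI : (primeSpec p).asIdeal = Ideal.span {(p : ℤ_[p])} := PadicInt.maximalIdeal_eq_span_p
  obtain ⟨c, hc⟩ : ∃ c : ℕ, (primeSpec p).intValuation (p : ℤ_[p]) = WithZero.exp (-(c : ℤ)) :=
    ⟨_, (primeSpec p).intValuation_if_neg hne⟩
  have h1 : (primeSpec p).intValuation (p : ℤ_[p]) ≤ WithZero.exp (-((1 : ℕ) : ℤ)) := by
    rw [HeightOneSpectrum.intValuation_le_pow_iff_mem, pow_one, hI]
    exact Ideal.mem_span_singleton_self _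
  have h2 : ¬ (primeSpec p).intValuation (p : ℤ_[p]) ≤ WithZero.exp (-((2 : ℕ) : ℤ)) := by
    rw [HeightOneSpectrum.intValuation_le_pow_iff_mem, hI, Ideal.span_singleton_pow, Ideal.mem_span_singleton]
    rintro ⟨x, hx⟩
    -- `p = p² x` would make `p` a unit of `ℤ_[p]`
    have h1' : (p : ℤ_[p]) * 1 = p * (p * x) := by rw [mul_one, ← mul_assoc, ← sq]; exact hx
    have hunit : IsUnit (p : ℤ_[p]) := IsUnit.of_mul_eq_one x (mul_left_cancel₀ hne h1').symm
    exact PadicInt.p_nonunit hunit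
  rw [hc] at h1 h2 ⊢
  rw [WithZero.exp_le_exp] at h1 h2
  push_cast at h1 h2
  have : (c : ℤ) = 1 := by omega
  rw [this]

end PadicDivisible

namespace LogDivisorModel.TateTowerArith

open PadicDivisible

/-- **The arithmetic Tate tower datum over the MLF `ℚ_p`** (class (b) inhabitant of `TateTowerArith.Datum` with a LOCAL
constant field): `K = L = ℚ_p`, `v` = the `p`-adic valuation, `q = p`, Prop. 3.2 (iii) for `ℚ_p^×` PROVED; `Aut(L/K)`
trivial. [cite: MochizukiEtTh2009, Def 3.1 p.70] -/
def Datum.padic (p : ℕ) [Fact p.Prime] : Datum ℚ_[p] ℚ_[p] where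
  v := (primeSpec p).valuation ℚ_[p]
  finiteDimensional := inferInstance
  v_algEquiv σ x := by
    have hx : σ x = x := by
      have h := σ.commutes x
      rwa [Algebra.algebraMap_self_apply] at h
    rw [hx]
  q := p
  v_q := by
    rw [Algebra.algebraMap_self_apply]
    exact valuation_primeSpec_self p
  eq_one_of_divisible := PadicDivisible.units_eq_one_of_forall_exists_pow_eq p

/-- `Datum ℚ_p ℚ_p` is inhabited. [cite: MochizukiEtTh2009, Def 3.1 p.70] -/
theorem nonempty_datum_padic (p : ℕ) [Fact p.Prime] : Nonempty (Datum ℚ_[p] ℚ_[p]) := ⟨Datum.padic p⟩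

/-- The Galois-correspondence law of the model file at the `ℚ_p`-tower (non-vacuity over a LOCAL constant field).
[cite: MochizukiEtTh2009, Thm 3.7 (iii) p.79] -/
theorem constGaloisLaw_padic (p : ℕ) [Fact p.Prime] : (Datum.padic p).action.ConstGaloisLaw :=
  (Datum.padic p).constGaloisLaw

/-- In the `ℚ_p`-tower the integral constants `O^▷` are the `p`-adic integers: `c·U^0 ∈ O^▷` iff `v_p c ≤ 1`.
[cite: MochizukiEtTh2009, Prop 3.4 p.74] -/
theorem padic_emb_mem_intConst_iff (p : ℕ) [Fact p.Prime] (c : ℚ_[p]ˣ) :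
    (Datum.padic p).constField.emb c ∈ (Datum.padic p).model.intConst ↔
      (primeSpec p).valuation ℚ_[p] (c : ℚ_[p]) ≤ 1 :=
  (Datum.padic p).constField.emb_mem_intConst_iff c

end LogDivisorModel.TateTowerArith

end Literature.AnabelianGeometry.EtaleTheta

end
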